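import Mathlib
import HarnessLib
import Summits.HubbardSuperconductivity.HubbardSuperconductivity.Theorems.KLProgrammeKLRegimeEnginePairTransferDLineEdgeSplitCellsDoorSharpTC
import Summits.HubbardSuperconductivity.HubbardSuperconductivity.Theorems.KLProgrammeKLRegimeEnginePairTransferDLineEdgePinnedFiveSlotTCL

/-!
# Route `KLProgramme` — ENGINE item stmt-HubbardSuperconductivity-20437 `KLRegimeEngineV17F2`, class #5 rev 3 — «88b» THE PINNED PAIR: the five-slot ADAPTER ON
# ANGULAR-CELL DATA, part 1: the slot readings at nonnegative transfer and the scale-free/defect arithmetic (`pinned_row_le_slotsTCC₀/_shiftTCC₀`, `klpc_*`)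

Cell gate-hubbard-kl, seat hubbard-kl-k3c1-p1 g22 (composed-map remainder propagation).  The (X).3 one-call «95v2» asks, per pinned pair (`1 ≤ n`, `j′ = n+1`), the signed
direct/crossed `D`-rows in the FIVE-SLOT form `(KlamU)²·(z·4^{−(n+1)} + h·4^{−(n_β−n)} + w·2⁻ⁿ + l·L⁻¹ + t·min)`.  The adapters of record (`…fiveSlotS′/TC′/SL/TCL`) fed them from
k3c2-p2's split3 doors with SUP data (global Lipschitz `L₁`, sup flatness `ε₁`, one sign-blind window) — the located COOPER-ANTIPODE interface (pen (R437)/(R448)).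
k3c2-p2 g26's cell door `dLine_pinned_direct/crossed_splitCells_doorTC` (✓ p726872, …DLineEdgeSplitCellsDoorSharpTC) books instead ANGULAR-CELL data: arcs
`[α_c, β_c]` with serving sets `S_c` and cell Lipschitz constants `Lc_c` (arc-weighted sum `I₁ = Σ_c Lc_c(β_c − α_c)`), ONE global Lipschitz constant `K_g` (lattice→continuum
only), the scale-free quasi-Lipschitz defect `I_δ = Σ_c (2Lc_c + 4K_g)(π/L)(β_c − α_c)`, a window FAMILY `(cen_w, ρ_w, A₂ʷ)` and a flatness `ε₁` that may be `0`.
THIS FILE composes that door into the SAME five-slot conclusions: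
* §0 `pinned_row_le_slotsTCC₀`, `pinned_row_le_slots_shiftTCC₀` — k3c2-p2's slot readings of `klmsRowBoundTCC` with `0 ≤ r` (zero transfer included);
* §1 `klpc_scaled_div_L_le` (a constant `X` with the SCALE-FREE datum `X·Λ_m ≤ x`, `m ≤ n_β+1`, over the registered volume `klEngL₄ ≤ L`:
  `X/L ≤ x·U/(2⁷²·Psq²Rsq²)·4^{−(n+1)}`), `klpc_defect_sum_eq`, `klpc_defect_le` (the defect entry `(3/π)DEF⋆`: its `I₁` part is an `l/L` quantity
  `κ′·2I₁/L`, its `K_g` part `κ′·4K_gΣ(β_c−α_c)/L` an OVERLAP-slot quantity through the scale-free datum — no n-flatness asked of `K_g`);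
* §2 **`dLine_pinned_direct_fiveSlotTCC`**, **`dLine_pinned_crossed_fiveSlotTCC`**: binders = the cell door's + `0 < U`, `klEngL₄ P R β U ≤ L`, `K_g·Λ_{m₁} ≤ kg`
  (`m₁ ≤ n_β+1`), `Σ_c(β_c − α_c) ≤ Θ`; size rows: `hz` = ZS of the `c`-row + ZS_C of the `F₁`-row (arc-weighted `I₁`) + windows `Σ_w A₂ʷ·1024·15381·ρ_w/π`
  + the three L-row coefficients (`c`-lattice, `F₁`-lattice with `kg`, defect `K_g`-part) on `4^{−(n+1)}`; `hh` = the two thermal entries; `hw : ε₁·512·15367 ≤ (KlamU)²w2⁻ⁿ`;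
  `hl : Σ_w A₂ʷ·1024·15381 + κ′·2I₁ ≤ (KlamU)²·l` (L-free, n-flat); `htt` = the two transfer entries.  Every datum that was SUP over the loop angle is now arc-weighted
  (θ-averaged) or scale-free — the cure (A″) shape; the spine «95v2» is untouched.
Pure composition + real arithmetic over landed rows; the split, the cells and the binders are hypotheses; nothing about the model's sizes is asserted; nothing asserts (X).3,
(c), K3 or superconductivity.  0 kit · 0 lit.  References: BGM 2006 §2.3–2.4 [cite: BenfattoGiulianiMastropietro2006].
-/

noncomputable section

namespace Summit.HubbardSuperconductivity.HubbardSuperconductivity.Theorems.KLRegimeSplit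

set_option linter.dupNamespace false -- summit = problem name (single-conjunct summit), D-0017

open Real Set Finset Complex Literature.MathematicalPhysics.QuantumLattice
open Literature.Probability.LatticeModels hiding torusSupNorm
open Literature.MathematicalPhysics.QuantumLattice.BandSectorCounting
open Summit.HubbardSuperconductivity.HubbardSuperconductivity.Theorems.KLProgrammeLegKernels
open Summit.HubbardSuperconductivity.HubbardSuperconductivity.Theorems.KLRegimeWick
open Summit.HubbardSuperconductivity.HubbardSuperconductivity.Theorems.TwoPointAssembly
open Summit.HubbardSuperconductivity.HubbardSuperconductivity.Theorems.DispersionFlow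
open Summit.HubbardSuperconductivity.HubbardSuperconductivity.Theorems.PerturbedFermiCurve
open Summit.HubbardSuperconductivity.HubbardSuperconductivity.Theorems.EngineV8

variable {L M : ℕ} [NeZero L] [NeZero M] (β μ : ℝ) (K : TrigPolyC4v)

/-! ## §0 The angular-cell slot readings at nonnegative transfer -/

/-- `pinned_row_le_slotsTCC` (k3c2-p2 g26, …DLineEdgeSplitCellsDoorSharpTC) with `0 ≤ r` (zero transfer included; `klpp_div_eq_min_of_nonneg`). [folklore] -/
theorem pinned_row_le_slotsTCC₀ {d A G A₀ Kg I₁ Iδ : ℝ} (hdA : 0 < d - 4 * A) (hA : 0 ≤ A) (hG : 0 ≤ G) (hA0 : 0 ≤ A₀) (hI1 : 0 ≤ I₁) (hIδ : 0 ≤ Iδ)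
    (hβ : klBetaMin ≤ β) {n : ℕ} (hn : n ≤ nScales β) {r : ℝ} (hr : 0 ≤ r) (hrΛ : r ≤ klScale klE0 (n + 1)) :
    2 * ((klScale klE0 n - klScale klE0 (n + 1)) * klmsRowBoundTCC d A G A₀ Kg I₁ Iδ β n (n + 2) (G * r) L) ≤
      3 / π * (64 / Real.pi * 8 *
              (Real.pi * Real.sqrt 2 / (d - 4 * A) / (d - 4 * A) * (I₁ / (2 * π)) +
                Real.pi * Real.sqrt 2 / (d - 4 * A) * (2 * A₀ * (2 / (1 / 10))) / (d - 4 * A) +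
                2 * A₀ * (1 / (d - 4 * A) ^ 2 + Real.pi * Real.sqrt 2 * (2 + 4 * A) / (d - 4 * A) ^ 3))) *
          klE0 * ((4 : ℝ) ^ (n + 1))⁻¹ +
        12 / π * ((393216 / Real.pi * (64 * 16 + (2 * (448 / 3 * Real.exp 2) + 8) + 64) * (2 * A₀ * (Real.pi * Real.sqrt 2 / (d - 4 * A)))) +
            (48 / Real.pi * 8 * (2 * A₀ * (Real.pi * Real.sqrt 2 / (d - 4 * A))) * (3 * (8 * (16 : ℝ)) + 512 * 1)) * G) *
          ((4 : ℝ) ^ (nScales β - n))⁻¹ +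
        3 / π * (64 / Real.pi * 8 * (2 * A₀ * (Real.pi * Real.sqrt 2 / (d - 4 * A))) * (3 * (8 * (16 : ℝ)) + 512 * 1)) *
          (G * min (r / klScale klE0 (n + 1)) (klScale klE0 (n + 1) / r)) +
        3 / π * (128 / Real.pi * 8 * (Real.pi * Real.sqrt 2 / (d - 4 * A)) * (Iδ / (2 * π))) +
        2 * ((96 * (512 * Kg / klScale klE0 (n + 1) +
            32 * A₀ * G * ((9 * (2 * (448 / 3 * Real.exp 2) + 8) + 4 * 8) + (3 * (8 * (16 : ℝ)) + 512 * 1)) /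
              klScale klE0 (n + 1) ^ 2)) / L) := by
  have hπ := Real.pi_pos
  have hβ0 : 0 < β := lt_of_lt_of_le (by norm_num [klBetaMin]) hβ
  have hΛ1 := klth_klScale_pos (n + 1)
  rw [pinned_rowBound_readingTCC]
  -- abbreviate the closed constants
  set ZS : ℝ := 64 / Real.pi * 8 *
      (Real.pi * Real.sqrt 2 / (d - 4 * A) / (d - 4 * A) * (I₁ / (2 * π)) +
                Real.pi * Real.sqrt 2 / (d - 4 * A) * (2 * A₀ * (2 / (1 / 10))) / (d - 4 * A) +
                2 * A₀ * (1 / (d - 4 * A) ^ 2 + Real.pi * Real.sqrt 2 * (2 + 4 * A) / (d - 4 * A) ^ 3)) with hZS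
  set DEF : ℝ := 128 / Real.pi * 8 * (Real.pi * Real.sqrt 2 / (d - 4 * A)) * (Iδ / (2 * π)) with hDEF
  have hDEF0 : 0 ≤ DEF := by rw [hDEF]; positivity
  set TH : ℝ := (393216 / Real.pi * (64 * 16 + (2 * (448 / 3 * Real.exp 2) + 8) + 64) * (2 * A₀ * (Real.pi * Real.sqrt 2 / (d - 4 * A)))) with hTH
  set TRf : ℝ := (64 / Real.pi * 8 * (2 * A₀ * (Real.pi * Real.sqrt 2 / (d - 4 * A))) * (3 * (8 * (16 : ℝ)) + 512 * 1)) with hTRf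
  set TRt : ℝ := (48 / Real.pi * 8 * (2 * A₀ * (Real.pi * Real.sqrt 2 / (d - 4 * A))) * (3 * (8 * (16 : ℝ)) + 512 * 1)) with hTRt
  set LAT : ℝ := (96 * (512 * Kg / klScale klE0 (n + 1) +
            32 * A₀ * G * ((9 * (2 * (448 / 3 * Real.exp 2) + 8) + 4 * 8) + (3 * (8 * (16 : ℝ)) + 512 * 1)) /
              klScale klE0 (n + 1) ^ 2)) with hLAT
  obtain ⟨hZS0, hTH0, hTRf0, hTRt0⟩ : 0 ≤ ZS ∧ 0 ≤ TH ∧ 0 ≤ TRf ∧ 0 ≤ TRt :=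
    ⟨by rw [hZS]; positivity, by rw [hTH]; positivity, by rw [hTRf]; positivity, by rw [hTRt]; positivity⟩
  clear_value ZS DEF TH TRf TRt LAT
  -- the dictionary lines
  have hΛeq : klScale klE0 (n + 1) = klE0 * ((4 : ℝ) ^ (n + 1))⁻¹ := rfl
  have hth := klmsRoom_thermal_le hβ hn
  set q : ℝ := ((4 : ℝ) ^ (nScales β - n))⁻¹ with hq
  set p : ℝ := (Real.pi / β) / klScale klE0 (n + 1) with hp
  set mn : ℝ := min (r / klScale klE0 (n + 1)) (klScale klE0 (n + 1) / r) with hmn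
  have hp0 : 0 ≤ p := by rw [hp]; positivity
  have hth' : p ≤ 4 * q := hth
  have hmn0 : 0 ≤ mn := by rw [hmn]; exact le_min (by positivity) (by positivity)
  have hmn1 : mn ≤ 1 := min_slot_le_one₀ hr hrΛ
  have hmin : (|(0 : ℝ)| + G * r) / klScale klE0 (n + 1) = G * mn := by
    rw [hmn, ← klpp_div_eq_min_of_nonneg hr hrΛ, abs_zero, zero_add, mul_div_assoc]
  rw [hmin]
  have h1 : 3 / (2 * π) * (ZS * klScale klE0 (n + 1)) = 1 / 2 * (3 / π * ZS * klE0 * ((4 : ℝ) ^ (n + 1))⁻¹) := by rw [hΛeq]; ring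
  have h2 : 3 / (2 * π) * (TH * p) ≤ 1 / 2 * (12 / π * TH * q) := by
    have := mul_le_mul_of_nonneg_left hth' (by positivity : 0 ≤ 3 / (2 * π) * TH)
    calc 3 / (2 * π) * (TH * p) = 3 / (2 * π) * TH * p := by ring
      _ ≤ 3 / (2 * π) * TH * (4 * q) := this
      _ = 1 / 2 * (12 / π * TH * q) := by ring
  have h3 : 3 / (2 * π) * ((TRf + TRt * p) * (G * mn)) ≤ 1 / 2 * (3 / π * TRf * (G * mn)) + 1 / 2 * (12 / π * (TRt * G) * q) := by
    have hGmn : G * mn ≤ G := (mul_le_mul_of_nonneg_left hmn1 hG).trans_eq (mul_one G)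
    have ha : TRt * p * (G * mn) ≤ TRt * (4 * q) * G :=
      mul_le_mul (mul_le_mul_of_nonneg_left hth' hTRt0) hGmn (by positivity) (by positivity)
    have e : 3 / (2 * π) * ((TRf + TRt * p) * (G * mn)) = 1 / 2 * (3 / π * TRf * (G * mn)) + 3 / (2 * π) * (TRt * p * (G * mn)) := by ring
    rw [e]
    have : 3 / (2 * π) * (TRt * p * (G * mn)) ≤ 3 / (2 * π) * (TRt * (4 * q) * G) := mul_le_mul_of_nonneg_left ha (by positivity)
    have e2 : 3 / (2 * π) * (TRt * (4 * q) * G) = 1 / 2 * (12 / π * (TRt * G) * q) := by ring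
    linarith
  have hsplit : 3 / (2 * π) * (ZS * klScale klE0 (n + 1) + DEF + TH * p + (TRf + TRt * p) * (G * mn)) =
      3 / (2 * π) * (ZS * klScale klE0 (n + 1)) + 3 / (2 * π) * DEF + 3 / (2 * π) * (TH * p) + 3 / (2 * π) * ((TRf + TRt * p) * (G * mn)) := by ring
  rw [hsplit, h1]
  have hdef : 2 * (3 / (2 * π) * DEF) = 3 / π * DEF := by ring
  have e12 : 12 / π * (TH + TRt * G) * q = 12 / π * TH * q + 12 / π * (TRt * G) * q := by ring
  rw [e12]
  linarith

/-- `pinned_row_le_slots_shiftTCC` (k3c2-p2 g26) with `0 ≤ r` (zero transfer included). [folklore] -/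
theorem pinned_row_le_slots_shiftTCC₀ {d A G A₀ Kg I₁ Iδ : ℝ} (hdA : 0 < d - 4 * A) (hA : 0 ≤ A) (hG : 0 ≤ G) (hA0 : 0 ≤ A₀) (hI1 : 0 ≤ I₁) (hIδ : 0 ≤ Iδ)
    (hβ : klBetaMin ≤ β) {n : ℕ} (hn : n ≤ nScales β) {r : ℝ} (hr : 0 ≤ r) (hrΛ : r ≤ klScale klE0 (n + 1)) {s : ℝ} (hs : |s| = 2 * π / β) :
    2 * ((klScale klE0 n - klScale klE0 (n + 1)) * klmsRowBoundTCC d A G A₀ Kg I₁ Iδ β n (n + 2) (|s| + G * r) L) ≤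
      3 / π * (64 / Real.pi * 8 *
              (Real.pi * Real.sqrt 2 / (d - 4 * A) / (d - 4 * A) * (I₁ / (2 * π)) +
                Real.pi * Real.sqrt 2 / (d - 4 * A) * (2 * A₀ * (2 / (1 / 10))) / (d - 4 * A) +
                2 * A₀ * (1 / (d - 4 * A) ^ 2 + Real.pi * Real.sqrt 2 * (2 + 4 * A) / (d - 4 * A) ^ 3))) *
          klE0 * ((4 : ℝ) ^ (n + 1))⁻¹ +
        12 / π * ((393216 / Real.pi * (64 * 16 + (2 * (448 / 3 * Real.exp 2) + 8) + 64) * (2 * A₀ * (Real.pi * Real.sqrt 2 / (d - 4 * A)))) +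
            2 * (64 / Real.pi * 8 * (2 * A₀ * (Real.pi * Real.sqrt 2 / (d - 4 * A))) * (3 * (8 * (16 : ℝ)) + 512 * 1)) +
            8 * (48 / Real.pi * 8 * (2 * A₀ * (Real.pi * Real.sqrt 2 / (d - 4 * A))) * (3 * (8 * (16 : ℝ)) + 512 * 1)) +
            (48 / Real.pi * 8 * (2 * A₀ * (Real.pi * Real.sqrt 2 / (d - 4 * A))) * (3 * (8 * (16 : ℝ)) + 512 * 1)) * G) *
          ((4 : ℝ) ^ (nScales β - n))⁻¹ +
        3 / π * (64 / Real.pi * 8 * (2 * A₀ * (Real.pi * Real.sqrt 2 / (d - 4 * A))) * (3 * (8 * (16 : ℝ)) + 512 * 1)) *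
          (G * min (r / klScale klE0 (n + 1)) (klScale klE0 (n + 1) / r)) +
        3 / π * (128 / Real.pi * 8 * (Real.pi * Real.sqrt 2 / (d - 4 * A)) * (Iδ / (2 * π))) +
        2 * ((96 * (512 * Kg / klScale klE0 (n + 1) +
            32 * A₀ * G * ((9 * (2 * (448 / 3 * Real.exp 2) + 8) + 4 * 8) + (3 * (8 * (16 : ℝ)) + 512 * 1)) /
              klScale klE0 (n + 1) ^ 2)) / L) := by
  have hπ := Real.pi_pos
  have hβ0 : 0 < β := lt_of_lt_of_le (by norm_num [klBetaMin]) hβ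
  have hΛ1 := klth_klScale_pos (n + 1)
  rw [pinned_rowBound_readingTCC, hs]
  set ZS : ℝ := 64 / Real.pi * 8 *
      (Real.pi * Real.sqrt 2 / (d - 4 * A) / (d - 4 * A) * (I₁ / (2 * π)) +
                Real.pi * Real.sqrt 2 / (d - 4 * A) * (2 * A₀ * (2 / (1 / 10))) / (d - 4 * A) +
                2 * A₀ * (1 / (d - 4 * A) ^ 2 + Real.pi * Real.sqrt 2 * (2 + 4 * A) / (d - 4 * A) ^ 3)) with hZS
  set DEF : ℝ := 128 / Real.pi * 8 * (Real.pi * Real.sqrt 2 / (d - 4 * A)) * (Iδ / (2 * π)) with hDEF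
  have hDEF0 : 0 ≤ DEF := by rw [hDEF]; positivity
  set TH : ℝ := (393216 / Real.pi * (64 * 16 + (2 * (448 / 3 * Real.exp 2) + 8) + 64) * (2 * A₀ * (Real.pi * Real.sqrt 2 / (d - 4 * A)))) with hTH
  set TRf : ℝ := (64 / Real.pi * 8 * (2 * A₀ * (Real.pi * Real.sqrt 2 / (d - 4 * A))) * (3 * (8 * (16 : ℝ)) + 512 * 1)) with hTRf
  set TRt : ℝ := (48 / Real.pi * 8 * (2 * A₀ * (Real.pi * Real.sqrt 2 / (d - 4 * A))) * (3 * (8 * (16 : ℝ)) + 512 * 1)) with hTRt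
  set LAT : ℝ := (96 * (512 * Kg / klScale klE0 (n + 1) +
            32 * A₀ * G * ((9 * (2 * (448 / 3 * Real.exp 2) + 8) + 4 * 8) + (3 * (8 * (16 : ℝ)) + 512 * 1)) /
              klScale klE0 (n + 1) ^ 2)) with hLAT
  obtain ⟨hZS0, hTH0, hTRf0, hTRt0⟩ : 0 ≤ ZS ∧ 0 ≤ TH ∧ 0 ≤ TRf ∧ 0 ≤ TRt :=
    ⟨by rw [hZS]; positivity, by rw [hTH]; positivity, by rw [hTRf]; positivity, by rw [hTRt]; positivity⟩
  clear_value ZS DEF TH TRf TRt LAT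
  have hΛeq : klScale klE0 (n + 1) = klE0 * ((4 : ℝ) ^ (n + 1))⁻¹ := rfl
  have hth := klmsRoom_thermal_le hβ hn
  set q : ℝ := ((4 : ℝ) ^ (nScales β - n))⁻¹ with hq
  set p : ℝ := (Real.pi / β) / klScale klE0 (n + 1) with hp
  set mn : ℝ := min (r / klScale klE0 (n + 1)) (klScale klE0 (n + 1) / r) with hmn
  have hp0 : 0 ≤ p := by rw [hp]; positivity
  have hth' : p ≤ 4 * q := hth
  have hq1 : q ≤ 1 := by
    rw [hq]; exact inv_le_one_of_one_le₀ (one_le_pow₀ (by norm_num))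
  have hp4 : p ≤ 4 := hth'.trans ((mul_le_mul_of_nonneg_left hq1 (by norm_num : (0 : ℝ) ≤ 4)).trans_eq (mul_one 4))
  have hmn0 : 0 ≤ mn := by rw [hmn]; exact le_min (by positivity) (by positivity)
  have hmn1 : mn ≤ 1 := min_slot_le_one₀ hr hrΛ
  have hsplit : (|(0 : ℝ)| + (2 * π / β + G * r)) / klScale klE0 (n + 1) = 2 * p + G * mn := by
    rw [hmn, ← klpp_div_eq_min_of_nonneg hr hrΛ, abs_zero, zero_add, hp]
    field_simp
  rw [hsplit]
  have h1 : 3 / (2 * π) * (ZS * klScale klE0 (n + 1)) = 1 / 2 * (3 / π * ZS * klE0 * ((4 : ℝ) ^ (n + 1))⁻¹) := by rw [hΛeq]; ring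
  have h2 : 3 / (2 * π) * (TH * p) ≤ 1 / 2 * (12 / π * TH * q) := by
    have := mul_le_mul_of_nonneg_left hth' (by positivity : 0 ≤ 3 / (2 * π) * TH)
    calc 3 / (2 * π) * (TH * p) = 3 / (2 * π) * TH * p := by ring
      _ ≤ 3 / (2 * π) * TH * (4 * q) := this
      _ = 1 / 2 * (12 / π * TH * q) := by ring
  -- the transfer piece against `2p + G·mn`
  have hGmn : G * mn ≤ G := (mul_le_mul_of_nonneg_left hmn1 hG).trans_eq (mul_one G)
  have h2p : 2 * p ≤ 8 * q := (mul_le_mul_of_nonneg_left hth' (by norm_num : (0 : ℝ) ≤ 2)).trans_eq (by ring)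
  have ha : TRf * (2 * p) ≤ TRf * (8 * q) := mul_le_mul_of_nonneg_left h2p hTRf0
  have hb : TRt * p * (2 * p) ≤ TRt * (32 * q) := by
    have h8 : p * (2 * p) ≤ 4 * (2 * p) := mul_le_mul_of_nonneg_right hp4 (by positivity)
    have h32 : 4 * (2 * p) ≤ 32 * q := (mul_le_mul_of_nonneg_left h2p (by norm_num : (0 : ℝ) ≤ 4)).trans_eq (by ring)
    calc TRt * p * (2 * p) = TRt * (p * (2 * p)) := by ring
      _ ≤ TRt * (32 * q) := mul_le_mul_of_nonneg_left (h8.trans h32) hTRt0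
  have hc : TRt * p * (G * mn) ≤ TRt * (4 * q) * G :=
    mul_le_mul (mul_le_mul_of_nonneg_left hth' hTRt0) hGmn (by positivity) (by positivity)
  have h3 : 3 / (2 * π) * ((TRf + TRt * p) * (2 * p + G * mn)) ≤
      1 / 2 * (12 / π * (2 * TRf + 8 * TRt + TRt * G) * q) + 1 / 2 * (3 / π * TRf * (G * mn)) := by
    have e : (TRf + TRt * p) * (2 * p + G * mn) = TRf * (2 * p) + TRf * (G * mn) + TRt * p * (2 * p) + TRt * p * (G * mn) := by ring
    rw [e]
    have hsum : TRf * (2 * p) + TRf * (G * mn) + TRt * p * (2 * p) + TRt * p * (G * mn) ≤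
        TRf * (8 * q) + TRf * (G * mn) + TRt * (32 * q) + TRt * (4 * q) * G := by linarith
    have := mul_le_mul_of_nonneg_left hsum (by positivity : 0 ≤ 3 / (2 * π))
    have e2 : 3 / (2 * π) * (TRf * (8 * q) + TRf * (G * mn) + TRt * (32 * q) + TRt * (4 * q) * G) =
        1 / 2 * (12 / π * (2 * TRf + 8 * TRt + TRt * G) * q) + 1 / 2 * (3 / π * TRf * (G * mn)) := by ring
    linarith
  have hsum : 3 / (2 * π) * (ZS * klScale klE0 (n + 1) + DEF + TH * p + (TRf + TRt * p) * (2 * p + G * mn)) =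
      3 / (2 * π) * (ZS * klScale klE0 (n + 1)) + 3 / (2 * π) * DEF + 3 / (2 * π) * (TH * p) + 3 / (2 * π) * ((TRf + TRt * p) * (2 * p + G * mn)) := by ring
  rw [hsum, h1]
  have hdef : 2 * (3 / (2 * π) * DEF) = 3 / π * DEF := by ring
  have e12 : 12 / π * (TH + 2 * TRf + 8 * TRt + TRt * G) * q = 12 / π * TH * q + 12 / π * (2 * TRf + 8 * TRt + TRt * G) * q := by ring
  rw [e12]
  linarith

/-! ## §1 The scale-free constant over the registered volume; the defect entry -/

section LRowCells

omit [NeZero L] [NeZero M]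

/-- **A constant with a scale-free datum over the registered volume**: `0 ≤ X`, `X·Λ_m ≤ x`, `m ≤ n_β+1`, `klBetaMin ≤ β`, `0 < U`, `klEngL₄ P R β U ≤ L`, `n ≤ n_β` ⟹
`X/L ≤ x·U/(2⁷²·klEngPsq P²·klEngRsq R²)·4^{−(n+1)}` (`X ≤ (4/3)xβ`, `1/L ≤ U/(2⁶¹Psq²Rsq²β³)`, `β ≥ 128`, `β ≥ 24·4^{n+1}`). [folklore] -/
theorem klpc_scaled_div_L_le {P : SplitConsts} {R : RenConsts} {β U : ℝ} (hβ : klBetaMin ≤ β) (hU : 0 < U) {L : ℕ}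
    (hL : klEngL₄ P R β U ≤ L) {n : ℕ} (hn : n ≤ nScales β) {m : ℕ} (hm : m ≤ nScales β + 1) {X x : ℝ} (hX : 0 ≤ X)
    (hx : X * klScale klE0 m ≤ x) :
    X / L ≤ x * U / (2 ^ 72 * (klEngPsq P ^ 2 * klEngRsq R ^ 2)) * ((4 : ℝ) ^ (n + 1))⁻¹ := by
  have hβ0 : 0 < β := lt_of_lt_of_le (by norm_num [klBetaMin]) hβ
  have h128 : (128 : ℝ) ≤ β := by simpa [klBetaMin] using hβ
  have hLn := pos_of_klEngL₄_le hL
  have hLpos : (0 : ℝ) < L := by exact_mod_cast hLn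
  have hPR0 : 0 < klEngPsq P ^ 2 * klEngRsq R ^ 2 := mul_pos (pow_pos (klEngPsq_pos P) 2) (pow_pos (klEngRsq_pos R) 2)
  set PR : ℝ := klEngPsq P ^ 2 * klEngRsq R ^ 2 with hPR
  have h1L := klpl_one_div_le (P := P) (R := R) hβ hU hL
  rw [← hPR] at h1L
  have hXβ : X ≤ 4 / 3 * x * β := klpl_lip_le_of_scaled hβ hm hX hx
  have hx0 : 0 ≤ x := le_trans (mul_nonneg hX (klth_klScale_pos m).le) hx
  set Y : ℝ := (4 : ℝ) ^ (n + 1) with hY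
  have hY0 : 0 < Y := by positivity
  have hYβ : Y ≤ β / 24 := klpl_four_pow_succ_le hβ hn
  -- `X/L ≤ (4/3)xβ · U/(2^61 PR β³) = (4/3) x U/(2^61 PR β²)` and `1/β² ≤ 1/(3072·Y)`
  have hstep : X / L ≤ 4 / 3 * x * β * (U / (2 ^ 61 * PR * β ^ 3)) := by
    rw [div_eq_mul_one_div]
    exact mul_le_mul hXβ h1L (by positivity) (by positivity)
  refine hstep.trans ?_
  have e1 : 4 / 3 * x * β * (U / (2 ^ 61 * PR * β ^ 3)) = (x * U / PR) * (4 / 3 / (2 ^ 61 * β ^ 2)) := by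
    field_simp
  have e2 : x * U / (2 ^ 72 * PR) * Y⁻¹ = (x * U / PR) * (1 / (2 ^ 72 * Y)) := by
    field_simp
  rw [e1, e2]
  refine mul_le_mul_of_nonneg_left ?_ (by positivity)
  rw [div_le_div_iff₀ (by positivity) (by positivity)]
  nlinarith [mul_le_mul hYβ h128 (by norm_num) (by positivity)]

variable {ι : Type*} [Fintype ι]

/-- The defect sum, regrouped: `Σ_c (2Lc_c + 4K_g)(π/L)(β_c − α_c) = (π/L)·(2·Σ_c Lc_c(β_c − α_c) + 4K_g·Σ_c(β_c − α_c))`. [folklore] -/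
theorem klpc_defect_sum_eq (Lc αc βc : ι → ℝ) (Kg πL : ℝ) :
    ∑ c, (2 * Lc c + 4 * Kg) * πL * (βc c - αc c) = πL * (2 * ∑ c, Lc c * (βc c - αc c) + 4 * Kg * ∑ c, (βc c - αc c)) := by
  rw [Finset.mul_sum, Finset.mul_sum, mul_add, Finset.mul_sum, Finset.mul_sum, ← Finset.sum_add_distrib]
  exact Finset.sum_congr rfl fun c _ => by ring

/-- **The defect entry of the cell row, booked**: with `κ′ = (3/π)(128/π·8·(π√2/d_A))/2`, `0 < d_A`, `0 < L`, `0 ≤ K_g`, `0 ≤ Lc`, `α ≤ β`, `Σ(β_c − α_c) ≤ Θ` and the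
scale-free bound `K_g/L ≤ B` (e.g. `klpc_scaled_div_L_le`); `Lc` unrestricted:
`(3/π)·(128/π·8·(π√2/d_A)·(I_δ/(2π))) ≤ κ′·(2I₁)/L + κ′·(4Θ)·B`. [folklore] -/
theorem klpc_defect_le (dA : ℝ) (hdA : 0 < dA) {L : ℕ} (hL : (0 : ℝ) < L) {Kg : ℝ} (hKg : 0 ≤ Kg) {Lc αc βc : ι → ℝ}
    (hαβ : ∀ c, αc c ≤ βc c) {Θ B : ℝ} (hΘ : ∑ c, (βc c - αc c) ≤ Θ) (hB : Kg / L ≤ B) :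
    3 / π * (128 / Real.pi * 8 * (Real.pi * Real.sqrt 2 / dA) * ((∑ c, (2 * Lc c + 4 * Kg) * (Real.pi / L) * (βc c - αc c)) / (2 * π))) ≤
      3 / π * (128 / Real.pi * 8 * (Real.pi * Real.sqrt 2 / dA)) / 2 * (2 * ∑ c, Lc c * (βc c - αc c)) / L +
        3 / π * (128 / Real.pi * 8 * (Real.pi * Real.sqrt 2 / dA)) / 2 * (4 * Θ) * B := by
  have hπ := Real.pi_pos
  set κ : ℝ := 3 / π * (128 / Real.pi * 8 * (Real.pi * Real.sqrt 2 / dA)) / 2 with hκ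
  have hκ0 : 0 ≤ κ := by rw [hκ]; positivity
  set I₁ : ℝ := ∑ c, Lc c * (βc c - αc c) with hI₁
  set S : ℝ := ∑ c, (βc c - αc c) with hS
  have hS0 : 0 ≤ S := by rw [hS]; exact Finset.sum_nonneg fun c _ => sub_nonneg.2 (hαβ c)
  rw [klpc_defect_sum_eq]
  have e : 3 / π * (128 / Real.pi * 8 * (Real.pi * Real.sqrt 2 / dA) * (Real.pi / L * (2 * I₁ + 4 * Kg * S) / (2 * π))) =
      κ * (2 * I₁) / L + κ * (4 * S) * (Kg / L) := by
    rw [hκ]; field_simp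
  rw [e]
  have h1 : κ * (4 * S) * (Kg / L) ≤ κ * (4 * Θ) * B := by
    have hKgL : 0 ≤ Kg / L := by positivity
    calc κ * (4 * S) * (Kg / L) ≤ κ * (4 * Θ) * (Kg / L) :=
          mul_le_mul_of_nonneg_right (mul_le_mul_of_nonneg_left (by linarith) hκ0) hKgL
      _ ≤ κ * (4 * Θ) * B := mul_le_mul_of_nonneg_left hB (by nlinarith)
  linarith

end LRowCells


end Summit.HubbardSuperconductivity.HubbardSuperconductivity.Theorems.KLRegimeSplit

end
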